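import Summits.HubbardSuperconductivity.HubbardLadder.NeelSignUniformShellSixAfterC15
import Summits.HubbardSuperconductivity.HubbardLadder.NeelSignC06C4
import Summits.HubbardSuperconductivity.HubbardLadder.NeelSignC33C1
import HarnessLib

/-!
# The typed conjecture (S) through distance 6, CLOSED BY NAME: `NeelSignUniformUpTo 6` (HubbardLadder R2, lineage B)

HONEST FRAMING: ladder R1–R4 with certified numbers; no claim on H/H₀.  Reference model only (spin-½ Heisenberg antiferromagnet on
even tori); BOOKKEEPING over landed kernel rows in the style of `NeelSignUniformShellSix` — it proves no new inequality and asserts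
nothing about Néel order or the Hubbard model.  Inputs: `neelSignUniformUpTo_six_of_cells_06_33` (`NeelSignUniformShellSixAfterC15`:
shell 6 after `(1,5)` from the cells (0,6) and (3,3)), `neelSignCell_0_6` (`NeelSignC06C4`, certificate C4 of E-PR-30) and `neelSignCell_3_3` (`NeelSignC33C1`,
certificate `C1` of E-PR-31).  Pen: r2-eng-2 g16 (staged with the `(3,3)` road; files only after BOTH cell modules are BUILT).  What it names: with the
three cluster-cut cells `(1,5)`, `(0,6)`, `(3,3)` landed, EVERY cell of the typed conjecture (S) through distance 6 carries an `L`-uniform strict Néel sign —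
a statement about finitely many correlation cells of the reference model, NOT Néel order, NOT a statement about the Hubbard model.
[cite: KLS1988JSP, p. 1021] [cite: DLS1978, Theorem 4.2]
-/

noncomputable section

namespace Summit.HubbardSuperconductivity.HubbardLadder

open Literature.MathematicalPhysics.QuantumLattice Summit.HubbardSuperconductivity.Conjectures

/-! ### Shell 6 of the typed conjecture (S), closed BY NAME -/

/-- **The typed conjecture (S) through distance 6**: `NeelSignUniformUpTo 6` — every cell `(a,b)` with `1 ≤ a+b ≤ 6` carries a strict
`L`-uniform Néel sign (the tree's `neelSignUniformUpTo_six_of_cells_06_33` at `neelSignCell_0_6` and `neelSignCell_3_3`).  BOOKKEEPING ONLY over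
landed kernel rows — no new inequality.  HONEST FRAMING: ladder R1–R4 with certified numbers; no claim on H/H₀. [cite: KLS1988JSP, p. 1021] -/
theorem neelSignUniformUpTo_six : NeelSignUniformUpTo 6 :=
  neelSignUniformUpTo_six_of_cells_06_33 neelSignCell_0_6 neelSignCell_3_3

/-- Every distance `R ≤ 6` (monotonicity, for assembly). HONEST FRAMING: ladder R1–R4 with certified numbers; no claim on H/H₀. [cite: KLS1988JSP, p. 1021] -/
theorem neelSignUniformUpTo_of_le_six {R : ℕ} (hR : R ≤ 6) : NeelSignUniformUpTo R :=
  neelSignUniformUpTo_mono hR neelSignUniformUpTo_six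

end Summit.HubbardSuperconductivity.HubbardLadder

end
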